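import Mathlib
import HarnessLib

/-!
# Limits in distribution of INDEPENDENT sums, and of statistics of two independent codes read on
# the product space — the two lemmas behind an A-versus-B agreement test

HONEST FRAMING: exact (Metropolis-corrected) sampling algorithms for lattice gauge theory;
figures of merit are autocorrelation/cost numbers at stated couplings and volumes; no
continuum-physics claim.

Venture `LatticeQCDFlow` (cell pub-lqcd), topic `Scoring`; FANOUT row 4 (`s0-u1-b`, rung S0-B:
two independent codes compared column by column — "A vs B within `1σ_comb`").  Row 4's
central limit theorems are one-code statements; comparing two codes needs the joint behaviour of
two INDEPENDENT statistics, for which Mathlib's `TendstoInDistribution` API (Slutsky, continuous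
mapping) has no product rule.  This file supplies it for real statistics through characteristic
functions: by independence `φ_{Xₙ+Yₙ} = φ_{Xₙ}·φ_{Yₙ}` (`IndepFun.charFun_map_fun_add_eq_mul`),
and Lévy's continuity theorem (`ProbabilityMeasure.tendsto_iff_tendsto_charFun`) turns the
product of two convergent characteristic functions back into convergence in distribution:
**`tendstoInDistribution_add_of_indepFun`** (and `…_sub_…`).  Two codes live on their own
probability spaces; read on the product space `P_A ⊗ P_B` their statistics are independent
(`indepFun_prod₀`) and keep their one-code limits (**`tendstoInDistribution_comp_fst`**,
**`…_comp_snd`**), so the difference of the two centred, `√n`-scaled columns converges to the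
difference of two INDEPENDENT Gaussian limits (**`tendstoInDistribution_sub_twoCodes`**).
NEW WORK of the cell (elementary given Mathlib's Lévy theorem); no definition is introduced;
nothing is cited.

## Content

* `tendstoInDistribution_add_of_indepFun`, `tendstoInDistribution_sub_of_indepFun`;
* `tendstoInDistribution_comp_fst`, `tendstoInDistribution_comp_snd`;
* **`tendstoInDistribution_sub_twoCodes`** — `Xₙ ⇒ Z₁` under `P_A`, `Yₙ ⇒ Z₂` under `P_B`,
  `Z₁ ⟂ Z₂` ⇒ `Xₙ(ω_A) − Yₙ(ω_B) ⇒ Z₁ − Z₂` under `P_A ⊗ P_B`.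

NOT CLAIMED: vector-valued statistics; dependent codes (shared seeds); any number of ours
re-scored.
-/

noncomputable section

namespace Summit.Ventures.LatticeQCDFlow.Scoring.CardConsistency

open MeasureTheory ProbabilityTheory Filter
open scoped Topology

section IndependentSum

variable {Ω : Type*} [MeasurableSpace Ω] {P : Measure Ω} [IsProbabilityMeasure P]
variable {Ω' : Type*} [MeasurableSpace Ω'] {P' : Measure Ω'} [IsProbabilityMeasure P']

/-- **Independent sums converge in distribution to the independent sum of the limits**: real
statistics `Xₙ ⇒ Z₁`, `Yₙ ⇒ Z₂` with `Xₙ ⟂ Yₙ` for every `n` and `Z₁ ⟂ Z₂` ⇒ `Xₙ + Yₙ ⇒ Z₁ + Z₂`.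
[ours] (characteristic functions multiply; Lévy's continuity theorem) -/
theorem tendstoInDistribution_add_of_indepFun {X Y : ℕ → Ω → ℝ} {Z₁ Z₂ : Ω' → ℝ}
    (hX : TendstoInDistribution X atTop Z₁ (fun _ => P) P')
    (hY : TendstoInDistribution Y atTop Z₂ (fun _ => P) P')
    (hXY : ∀ n, IndepFun (X n) (Y n) P) (hZ : IndepFun Z₁ Z₂ P') :
    TendstoInDistribution (fun n ω => X n ω + Y n ω) atTop (fun ω' => Z₁ ω' + Z₂ ω')
      (fun _ => P) P' where
  forall_aemeasurable n := (hX.forall_aemeasurable n).add (hY.forall_aemeasurable n)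
  aemeasurable_limit := hX.aemeasurable_limit.add hY.aemeasurable_limit
  tendsto := by
    rw [ProbabilityMeasure.tendsto_iff_tendsto_charFun]
    intro t
    have hx := (ProbabilityMeasure.tendsto_iff_tendsto_charFun.1 hX.tendsto) t
    have hy := (ProbabilityMeasure.tendsto_iff_tendsto_charFun.1 hY.tendsto) t
    simp only [ProbabilityMeasure.coe_mk] at hx hy ⊢
    have h := hx.mul hy
    rw [← Pi.mul_apply (charFun (P'.map Z₁)) (charFun (P'.map Z₂)),
      ← hZ.charFun_map_fun_add_eq_mul hX.aemeasurable_limit hY.aemeasurable_limit] at h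
    refine h.congr' (Eventually.of_forall fun n => ?_)
    rw [← Pi.mul_apply (charFun (P.map (X n))) (charFun (P.map (Y n))),
      ← (hXY n).charFun_map_fun_add_eq_mul (hX.forall_aemeasurable n) (hY.forall_aemeasurable n)]

/-- **Independent differences**: `Xₙ ⇒ Z₁`, `Yₙ ⇒ Z₂`, `Xₙ ⟂ Yₙ`, `Z₁ ⟂ Z₂` ⇒
`Xₙ − Yₙ ⇒ Z₁ − Z₂`. [ours] -/
theorem tendstoInDistribution_sub_of_indepFun {X Y : ℕ → Ω → ℝ} {Z₁ Z₂ : Ω' → ℝ}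
    (hX : TendstoInDistribution X atTop Z₁ (fun _ => P) P')
    (hY : TendstoInDistribution Y atTop Z₂ (fun _ => P) P')
    (hXY : ∀ n, IndepFun (X n) (Y n) P) (hZ : IndepFun Z₁ Z₂ P') :
    TendstoInDistribution (fun n ω => X n ω - Y n ω) atTop (fun ω' => Z₁ ω' - Z₂ ω')
      (fun _ => P) P' := by
  have hY' : TendstoInDistribution (fun n ω => -Y n ω) atTop (fun ω' => -Z₂ ω') (fun _ => P) P' :=
    hY.continuous_comp (g := fun x : ℝ => -x) continuous_neg
  have h := tendstoInDistribution_add_of_indepFun hX hY'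
    (fun n => (hXY n).comp measurable_id measurable_neg) (hZ.comp measurable_id measurable_neg)
  simpa only [sub_eq_add_neg] using h

end IndependentSum

/-! ## Two codes on the product space -/

section TwoCodes

variable {ΩA : Type*} [MeasurableSpace ΩA] {PA : Measure ΩA} [IsProbabilityMeasure PA]
variable {ΩB : Type*} [MeasurableSpace ΩB] {PB : Measure ΩB} [IsProbabilityMeasure PB]
variable {Ω' : Type*} [MeasurableSpace Ω'] {P' : Measure Ω'} [IsProbabilityMeasure P']

/-- **A statistic of code `A` keeps its limit when read on the product space `P_A ⊗ P_B`.**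
[ours] -/
theorem tendstoInDistribution_comp_fst {X : ℕ → ΩA → ℝ} {Z : Ω' → ℝ}
    (hX : TendstoInDistribution X atTop Z (fun _ => PA) P') :
    TendstoInDistribution (fun n (ω : ΩA × ΩB) => X n ω.1) atTop Z (fun _ => PA.prod PB) P' := by
  have hm : ∀ n, AEMeasurable (fun ω : ΩA × ΩB => X n ω.1) (PA.prod PB) := fun n =>
    (hX.forall_aemeasurable n).comp_quasiMeasurePreserving Measure.quasiMeasurePreserving_fst
  refine ⟨hm, hX.aemeasurable_limit, ?_⟩
  have e : (fun n => (⟨(PA.prod PB).map fun ω : ΩA × ΩB => X n ω.1,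
      Measure.isProbabilityMeasure_map (hm n)⟩ : ProbabilityMeasure ℝ))
      = fun n => ⟨PA.map (X n), Measure.isProbabilityMeasure_map (hX.forall_aemeasurable n)⟩ := by
    funext n
    apply Subtype.ext
    show (PA.prod PB).map (fun ω : ΩA × ΩB => X n ω.1) = PA.map (X n)
    have h1 : AEMeasurable (X n) ((PA.prod PB).map Prod.fst) := by
      rw [Measure.map_fst_prod, measure_univ, one_smul]
      exact hX.forall_aemeasurable n
    rw [show (fun ω : ΩA × ΩB => X n ω.1) = X n ∘ Prod.fst from rfl,
      ← AEMeasurable.map_map_of_aemeasurable h1 measurable_fst.aemeasurable,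
      Measure.map_fst_prod, measure_univ, one_smul]
  rw [e]
  exact hX.tendsto

/-- **A statistic of code `B` keeps its limit when read on the product space `P_A ⊗ P_B`.**
[ours] -/
theorem tendstoInDistribution_comp_snd {Y : ℕ → ΩB → ℝ} {Z : Ω' → ℝ}
    (hY : TendstoInDistribution Y atTop Z (fun _ => PB) P') :
    TendstoInDistribution (fun n (ω : ΩA × ΩB) => Y n ω.2) atTop Z (fun _ => PA.prod PB) P' := by
  have hm : ∀ n, AEMeasurable (fun ω : ΩA × ΩB => Y n ω.2) (PA.prod PB) := fun n =>
    (hY.forall_aemeasurable n).comp_quasiMeasurePreserving Measure.quasiMeasurePreserving_snd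
  refine ⟨hm, hY.aemeasurable_limit, ?_⟩
  have e : (fun n => (⟨(PA.prod PB).map fun ω : ΩA × ΩB => Y n ω.2,
      Measure.isProbabilityMeasure_map (hm n)⟩ : ProbabilityMeasure ℝ))
      = fun n => ⟨PB.map (Y n), Measure.isProbabilityMeasure_map (hY.forall_aemeasurable n)⟩ := by
    funext n
    apply Subtype.ext
    show (PA.prod PB).map (fun ω : ΩA × ΩB => Y n ω.2) = PB.map (Y n)
    have h1 : AEMeasurable (Y n) ((PA.prod PB).map Prod.snd) := by
      rw [Measure.map_snd_prod, measure_univ, one_smul]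
      exact hY.forall_aemeasurable n
    rw [show (fun ω : ΩA × ΩB => Y n ω.2) = Y n ∘ Prod.snd from rfl,
      ← AEMeasurable.map_map_of_aemeasurable h1 measurable_snd.aemeasurable,
      Measure.map_snd_prod, measure_univ, one_smul]
  rw [e]
  exact hY.tendsto

/-- **TWO INDEPENDENT CODES: the difference of their statistics converges to the difference of
two INDEPENDENT limits.**  `Xₙ ⇒ Z₁` under `P_A`, `Yₙ ⇒ Z₂` under `P_B`, `Z₁ ⟂ Z₂` under `P'` ⇒
`(ω_A, ω_B) ↦ Xₙ(ω_A) − Yₙ(ω_B)` converges in distribution to `Z₁ − Z₂` under `P_A ⊗ P_B`.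
[ours] -/
theorem tendstoInDistribution_sub_twoCodes {X : ℕ → ΩA → ℝ} {Y : ℕ → ΩB → ℝ}
    {Z₁ Z₂ : Ω' → ℝ} (hX : TendstoInDistribution X atTop Z₁ (fun _ => PA) P')
    (hY : TendstoInDistribution Y atTop Z₂ (fun _ => PB) P') (hZ : IndepFun Z₁ Z₂ P') :
    TendstoInDistribution (fun n (ω : ΩA × ΩB) => X n ω.1 - Y n ω.2) atTop
      (fun ω' => Z₁ ω' - Z₂ ω') (fun _ => PA.prod PB) P' :=
  tendstoInDistribution_sub_of_indepFun (tendstoInDistribution_comp_fst hX)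
    (tendstoInDistribution_comp_snd hY)
    (fun n => indepFun_prod₀ (hX.forall_aemeasurable n) (hY.forall_aemeasurable n)) hZ

end TwoCodes

end Summit.Ventures.LatticeQCDFlow.Scoring.CardConsistency

end
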